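import Summits.QuantumFields.YangMills.Theorems.AlphaInputsT3ACv3AbelianSmall
import Literature.MathematicalPhysics.QuantumFieldTheory.Balaban1983to89.B14Eq216Concrete
import HarnessLib

/-!
# `AlphaInputsT3ACv3AbelianGlue` — STRATEGY B for 2′, toward (D6R-CHARGED): THE GLUE HOOK — a configuration that AGREES with a small-curl abelian configuration on the finest bonds feeding a
# level-`s` bond has the abelian `s`-fold (0.4)/`exp[mean log]` average there — lane `pub-balaban3d`, seat alpha-2 (g3)

WHAT (HOME `D6L-STATUS-alpha2-g3.md` §7: the candidate for (D6R-CHARGED) is a GLUED configuration — the [7]-with-domains lift under `Ω_k(h)`, the abelian profile outside; its averages in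
the profile region are computed by T4 locality).  ★ `iter_blockAvg_eq_gexpAt_of_eqOn_feeds` = `B14.Eq216Concrete.iter_local` ∘ `iter_blockAvg_gexpAt` (p563044).
HONEST FRAMING.  Kernel composition; nothing of [B10]∕[7]∕[4]'s estimates asserted; count-neutral helper toward R3 2′ (`stub_laneRecordsV3`, items 19935∕19936); nothing about d = 4, the
continuum, or a mass gap.

References: T. Bałaban, Commun. Math. Phys. 119 (1988) 243–285 [Balaban1988Convergent] ((2.11) p.256, locality of the averages); CMP 109 (1987) 249–301 [Balaban1987RG1] ((0.4) p.253).
-/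

set_option autoImplicit false

noncomputable section

namespace Summit.QuantumFields.YangMills.Theorems.AbelianEML

open scoped Matrix.Norms.L2Operator
open Literature.MathematicalPhysics.QuantumFieldTheory.Balaban1983to89
open Literature.MathematicalPhysics.QuantumFieldTheory.Balaban1983to89.BlockAveraging (blockAvg)
open Literature.MathematicalPhysics.QuantumFieldTheory.Balaban1983to89.B14.Eq216Concrete (feeds iter_local)
open Summit.QuantumFields.YangMills.Theorems.BalabanUVNodesN08AlphaAbelianLift (gexp)
open Summit.QuantumFields.Balaban3D.Carriers
open ExpMeanLog (expMeanLogSU deltaSU)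

variable {P : Params} {N : ℕ} [NeZero N] {Y : Matrix (Fin N) (Fin N) ℂ} (hY : Y ∈ (suGroupModel N).lie)

/-- **★ THE GLUE HOOK**: if `U` agrees with the abelian configuration `gexpAt a` on the finest bonds feeding the level-`s` bond `c` (`feeds s c`), the curls of `a` are `≤ B` everywhere and
the level-`s` threshold `(π/2)(((d+2)L)²/4)(L²)^s·B·‖Y‖ < min(δ_N, ln 2)` holds, then `M^s(U)(c) = gexp((linAvgIter s a)(c))` (standing range `s ≤ m+K`).
[cite: Balaban1988Convergent, (2.11) p.256; Balaban1987RG1, (0.4)+(0.11) p.253] -/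
theorem iter_blockAvg_eq_gexpAt_of_eqOn_feeds (hY0 : Y ≠ 0) (a : PBond P 0 → ℝ) {B : ℝ} (hB0 : 0 ≤ B)
    (hBall : ∀ (x : Site P 0) (μ ν : Fin P.d), |curlAt a x μ ν| ≤ B) {s : ℕ} (hs : s ≤ P.m + P.K)
    (hthr : Real.pi / 2 * (((((P.d + 2) * P.L : ℕ) : ℝ) ^ 2 / 4) * (((P.L : ℝ) ^ 2) ^ s * B)) * ‖Y‖ < min (deltaSU (Fin N)) (Real.log 2))
    (U : GaugeField P 0 (Matrix.specialUnitaryGroup (Fin N) ℂ)) (c : PBond P s) (hU : ∀ b₀ ∈ feeds s c, U b₀ = gexpAt (suGroupModel N) hY a b₀) :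
    Averaging.iter (fun i => blockAvg (P := P) (j := i) (expMeanLogSU (n := Fin N))) s U c = gexpAt (suGroupModel N) hY (linAvgIter s a) c := by
  rw [iter_local (fun i => blockAvg (P := P) (j := i) (expMeanLogSU (n := Fin N))) s hs U (gexpAt (suGroupModel N) hY a) c hU,
    iter_blockAvg_gexpAt hY hY0 a hB0 hBall s hthr]

/-- The same, read as a plaquette statement: if `U` agrees with `gexpAt a` on the bonds feeding the four bonds of the level-`s` plaquette `(y; μ, ν)`, then the plaquette variable of `M^s(U)`
there is `gexp` of the curl of `linAvgIter s a`. [cite: Balaban1988Convergent, (2.11) p.256; Balaban1985Averaging, (9) p.19] -/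
theorem plaqHol_iter_blockAvg_eq_of_eqOn_feeds (hY0 : Y ≠ 0) (a : PBond P 0 → ℝ) {B : ℝ} (hB0 : 0 ≤ B)
    (hBall : ∀ (x : Site P 0) (μ ν : Fin P.d), |curlAt a x μ ν| ≤ B) {s : ℕ} (hs : s ≤ P.m + P.K)
    (hthr : Real.pi / 2 * (((((P.d + 2) * P.L : ℕ) : ℝ) ^ 2 / 4) * (((P.L : ℝ) ^ 2) ^ s * B)) * ‖Y‖ < min (deltaSU (Fin N)) (Real.log 2))
    (U : GaugeField P 0 (Matrix.specialUnitaryGroup (Fin N) ℂ)) (p : Plaq P s)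
    (hU : ∀ b : PBond P s, (b = ⟨p.src, p.μ⟩ ∨ b = ⟨p.src.shift p.μ, p.ν⟩ ∨ b = ⟨p.src.shift p.ν, p.μ⟩ ∨ b = ⟨p.src, p.ν⟩) →
      ∀ b₀ ∈ feeds s b, U b₀ = gexpAt (suGroupModel N) hY a b₀) :
    GaugeField.plaqHol (Averaging.iter (fun i => blockAvg (P := P) (j := i) (expMeanLogSU (n := Fin N))) s U) p =
      gexp (suGroupModel N) hY (curlAt (linAvgIter s a) p.src p.μ p.ν) := by
  have h := fun b hb => iter_blockAvg_eq_gexpAt_of_eqOn_feeds hY hY0 a hB0 hBall hs hthr U b (hU b hb)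
  have hplaq : GaugeField.plaqHol (Averaging.iter (fun i => blockAvg (P := P) (j := i) (expMeanLogSU (n := Fin N))) s U) p =
      GaugeField.plaqHol (gexpAt (suGroupModel N) hY (linAvgIter s a)) p := by
    simp only [GaugeField.plaqHol]
    rw [h _ (Or.inl rfl), h _ (Or.inr (Or.inl rfl)), h _ (Or.inr (Or.inr (Or.inl rfl))), h _ (Or.inr (Or.inr (Or.inr rfl)))]
  rw [hplaq, plaqHol_gexpAt]
  rfl

end Summit.QuantumFields.YangMills.Theorems.AbelianEML

end
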